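import Mathlib
import Summits.CriticalPhenomena.SAWScalingLimit.Theses.SAWDevelopingMap
import Literature.Probability.RandomPlanarGeometry.LocalMartingaleProofs
import Literature.Probability.RandomPlanarGeometry.SLEUniquenessInLaw

/-!
# Crux `ObservableToSLE` (stmt-CriticalPhenomena-10472) is exactly identification of subsequential limits

Negative/structural lemmas (refuter, cdisprove gen 2).  Modulo the PROVED soft half
(`convergesInLawToSLE_of_isTightAlongMesh`, `IsSLECurve.map_eq_holds`), the crux
`HexObservableLimit → HexTight → HexConjecture` is equivalent to
`HexObservableLimit → HexTight → (every subsequential weak limit law of the critical hexagonal SAW is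
the chordal SLE(8/3) law)`; both directions are proved for `hexSAWLaw`'s junk-`0` convention
(finiteness of hexagonal SAWs in a bounded domain; Dirac padding of the push-forward laws), and the
identification target is not vacuous under tightness.
-/

noncomputable section

open Literature.Probability.RandomPlanarGeometry Literature.Probability.RandomPlanarGeometry.SAW
  Literature.Probability.LatticeModels Literature.Probability MeasureTheory Filter Topology Set
open scoped NNReal ENNReal BoundedContinuousFunction

namespace Summit.CriticalPhenomena.SAWScalingLimit.Theorems.ObservableToSLE.Negative

open Summit.CriticalPhenomena.SAWScalingLimit.Theses

/-! ### Finiteness of hexagonal SAWs in a bounded domain -/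

/-- Real and imaginary parts of the honeycomb vertices: `(x, k)` sits at
`x₀ + x₁/2 + (k+1)/2 + i (√3/2)(x₁ + (k+1)/3)`. [folklore] -/
theorem hexCenter_re_im (x : Site 2) (k : Fin 2) :
    (hexCenter (x, k)).re = x 0 + (x 1 : ℝ) / 2 + ((k : ℕ) + 1) / 2 ∧
    (hexCenter (x, k)).im = Real.sqrt 3 / 2 * (x 1 + ((k : ℕ) + 1) / 3) := by
  have hz : triZeta.re = 1 / 2 := by
    rw [triZeta, Complex.exp_re]
    simp [Real.cos_pi_div_three]
  have hzi : (triZeta).im = Real.sqrt 3 / 2 := by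
    rw [triZeta, Complex.exp_im]
    simp [Real.sin_pi_div_three]
  constructor
  · simp [hexCenter, triEmbed, hz, hzi]
    ring
  · simp [hexCenter, triEmbed, hz, hzi]
    ring

/-- In a bounded domain and at a nonzero mesh there are finitely many honeycomb mesh vertices. [folklore] -/
theorem finite_embMeshVertices_hex {Ω : Set ℂ} (hΩ : Bornology.IsBounded Ω) {δ : ℝ} (hδ : δ ≠ 0) :
    (embMeshVertices hexCenter Ω δ).Finite := by
  obtain ⟨R, hR⟩ := hΩ.subset_ball 0
  set M : ℝ := R / |δ| with hMdef
  have hM : ∀ v ∈ embMeshVertices hexCenter Ω δ, ‖hexCenter v‖ < M := by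
    intro v hv
    have h := hR hv
    rw [Metric.mem_ball, dist_zero_right, norm_mul, Complex.norm_real, Real.norm_eq_abs] at h
    rw [hMdef, lt_div_iff₀ (abs_pos.2 hδ)]
    linarith
  obtain ⟨N, hN⟩ : ∃ N : ℕ, 2 * M + 2 ≤ N := exists_nat_ge _
  let g : HexVertex → ℤ × ℤ × Fin 2 := fun v => (v.1 0, v.1 1, v.2)
  have hg : g.Injective := by
    rintro ⟨x, k⟩ ⟨y, l⟩ h
    simp only [g, Prod.mk.injEq] at h
    obtain ⟨h0, h1, rfl⟩ := h
    refine Prod.ext ?_ rfl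
    ext i
    fin_cases i
    · exact h0
    · exact h1
  let T : Finset (ℤ × ℤ × Fin 2) :=
    Finset.Icc (-(N : ℤ)) N ×ˢ (Finset.Icc (-(N : ℤ)) N ×ˢ Finset.univ)
  refine ((T.finite_toSet.preimage hg.injOn)).subset ?_
  rintro ⟨x, k⟩ hv
  have hn := hM _ hv
  have hre := (Complex.abs_re_le_norm (hexCenter (x, k))).trans_lt hn
  have him := (Complex.abs_im_le_norm (hexCenter (x, k))).trans_lt hn
  rw [(hexCenter_re_im x k).1] at hre
  rw [(hexCenter_re_im x k).2] at him
  have hk : ((k : ℕ) : ℝ) ≤ 1 := by exact_mod_cast Nat.lt_succ_iff.1 k.2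
  have hk0 : (0 : ℝ) ≤ (k : ℕ) := Nat.cast_nonneg _
  have hs3 : (1 : ℝ) ≤ Real.sqrt 3 := by
    rw [show (1 : ℝ) = Real.sqrt 1 by simp]
    exact Real.sqrt_le_sqrt (by norm_num)
  have h1 : |(x 1 : ℝ)| ≤ 2 * M + 1 := by
    rw [abs_mul, abs_of_pos (by positivity : (0 : ℝ) < Real.sqrt 3 / 2)] at him
    have : |(x 1 : ℝ) + ((k : ℕ) + 1) / 3| < 2 * M := by
      have h2 : (1 / 2 : ℝ) * |(x 1 : ℝ) + ((k : ℕ) + 1) / 3| ≤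
          Real.sqrt 3 / 2 * |(x 1 : ℝ) + ((k : ℕ) + 1) / 3| :=
        mul_le_mul_of_nonneg_right (by linarith) (abs_nonneg _)
      linarith
    rw [abs_lt] at this
    rw [abs_le]
    constructor <;> linarith
  have h0 : |(x 0 : ℝ)| ≤ 2 * M + 2 := by
    rw [abs_lt] at hre
    rw [abs_le] at h1 ⊢
    constructor <;> linarith
  have h0' : |(x 0 : ℝ)| ≤ N := h0.trans hN
  have h1' : |(x 1 : ℝ)| ≤ N := by linarith
  rw [abs_le] at h0' h1'
  show g (x, k) ∈ (T : Set (ℤ × ℤ × Fin 2))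
  rw [Finset.mem_coe]
  simp only [g, T, Finset.mem_product, Finset.mem_Icc, Finset.mem_univ, and_true]
  refine ⟨⟨?_, ?_⟩, ?_, ?_⟩
  · exact_mod_cast h0'.1
  · exact_mod_cast h0'.2
  · exact_mod_cast h1'.1
  · exact_mod_cast h1'.2

/-- Every vertex of a walk of `Ω_δ` after the first lies in the discrete domain `Ω_δ`. [folklore] -/
theorem mem_embMeshDomain_of_mem_support_tail {V : Type*} {G : SimpleGraph V} {emb : V → ℂ}
    {Ω : Set ℂ} {δ : ℝ} {u v : V} (p : (embDomainGraph G emb Ω δ).Walk u v) {w : V}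
    (hw : w ∈ p.support.tail) : w ∈ embMeshDomain G emb Ω δ := by
  rw [← SimpleGraph.Walk.map_snd_darts] at hw
  obtain ⟨d, -, rfl⟩ := List.mem_map.1 hw
  exact ((embDomainGraph_adj_iff G emb).1 d.adj).2.2

/-- In a bounded domain and at a nonzero mesh there are finitely many hexagonal SAWs between two
given vertices. [folklore] -/
theorem finite_hexDomainSAW {Ω : Set ℂ} (hΩ : Bornology.IsBounded Ω) {δ : ℝ} (hδ : δ ≠ 0)
    (u v : HexVertex) : Finite (HexDomainSAW Ω δ u v) := by
  classical
  set S : Set HexVertex := insert u (embMeshVertices hexCenter Ω δ) with hS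
  haveI : Finite S := ((finite_embMeshVertices_hex hΩ hδ).insert u).to_subtype
  haveI : Fintype S := Fintype.ofFinite S
  have hsub : ∀ (γ : HexDomainSAW Ω δ u v), ∀ w ∈ γ.walk.support, w ∈ S := by
    intro γ w hw
    rw [← γ.walk.cons_tail_support, List.mem_cons] at hw
    rcases hw with rfl | hw
    · exact Set.mem_insert _ _
    · exact Set.mem_insert_of_mem _ (embMeshDomain_subset _ _ _ _
        (mem_embMeshDomain_of_mem_support_tail γ.walk hw))
  refine Finite.of_injective
    (fun γ => (⟨γ.walk.support.attachWith (· ∈ S) (hsub γ), ?_⟩ : {l : List ↥S // l.Nodup})) ?_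
  · refine List.Nodup.of_map Subtype.val ?_
    rw [List.attachWith_map_subtype_val]
    exact γ.isPath.support_nodup
  · intro γ γ' h
    have h' := congrArg (fun l : {l : List ↥S // l.Nodup} => l.1.map Subtype.val) h
    simp only [List.attachWith_map_subtype_val] at h'
    obtain ⟨w, hw⟩ := γ
    obtain ⟨w', hw'⟩ := γ'
    obtain rfl : w = w' := SimpleGraph.Walk.ext_support h'
    rfl

/-- If `u` and `v` are joined in `Ω_δ` (bounded `Ω`, `δ ≠ 0`), the critical hexagonal SAW law is a
probability measure. [folklore] -/
theorem isProbabilityMeasure_hexSAWLaw_of_reachable {Ω : Set ℂ} (hΩ : Bornology.IsBounded Ω)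
    {δ : ℝ} (hδ : δ ≠ 0) {u v : HexVertex} (h : (hexDomainGraph Ω δ).Reachable u v) :
    IsProbabilityMeasure (hexSAWLaw Ω δ u v) := by
  classical
  haveI := finite_hexDomainSAW hΩ hδ u v
  haveI := Fintype.ofFinite (HexDomainSAW Ω δ u v)
  obtain ⟨p⟩ := h
  let γ₀ : HexDomainSAW Ω δ u v := ⟨p.toPath.1, p.toPath.2⟩
  apply isProbabilityMeasure_hexSAWLaw
  · intro h0
    have : hexSAWWeight Ω δ u v {γ₀} = 0 := measure_mono_null (Set.subset_univ _) h0
    rw [hexSAWWeight_singleton] at this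
    exact absurd this (ENNReal.ofReal_pos.2 (pow_pos hexCriticalFugacity_pos_lt_one.1 _)).ne'
  · show embWeight hexGraph hexCenter Ω δ hexCriticalFugacity u v Set.univ ≠ ∞
    rw [embWeight, Measure.sum_apply _ MeasurableSpace.measurableSet_top, tsum_fintype]
    simp only [Measure.smul_apply, smul_eq_mul, Measure.dirac_apply_of_mem (Set.mem_univ _), mul_one]
    exact ENNReal.sum_ne_top.2 fun _ _ => ENNReal.ofReal_ne_top

/-- Under an endpoint approximation the critical hexagonal SAW laws are eventually probability
measures. [folklore] -/
theorem eventually_isProbabilityMeasure_hexSAWLaw {D : DobrushinDomain} {a b : ℝ → HexVertex}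
    (hab : IsEmbEndpointApprox hexGraph hexCenter D a b) :
    ∀ᶠ δ in 𝓝[>] (0 : ℝ), IsProbabilityMeasure (hexSAWLaw D.carrier δ (a δ) (b δ)) := by
  filter_upwards [hab.reachable, self_mem_nhdsWithin] with δ hr hδ
  exact isProbabilityMeasure_hexSAWLaw_of_reachable D.isBounded (ne_of_gt hδ) hr

/-! ### Identification -/

section Identification

variable {κ : ℝ≥0} {D : DobrushinDomain} {a b : ℝ → HexVertex}

/-- Convergence in law forces every subsequential limit law to be THE limit law (uniqueness of
weak limits of probability measures on the metric space `CurveClass ℂ`). [folklore] -/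
theorem isSLELaw_of_isSubseqLimitLaw
    (hc : ConvergesInLawToSLE κ D (fun δ (γ : HexDomainSAW D.carrier δ (a δ) (b δ)) => γ.curve)
      (fun δ => hexSAWLaw D.carrier δ (a δ) (b δ)))
    {μ : Measure (CurveClass ℂ)} [IsProbabilityMeasure μ]
    (hμ : IsSubseqLimitLaw (fun δ (γ : HexDomainSAW D.carrier δ (a δ) (b δ)) => γ.curve)
      (fun δ => hexSAWLaw D.carrier δ (a δ) (b δ)) μ) : IsSLELaw κ D μ := by
  obtain ⟨Γ, hΓ, -, hT⟩ := hc
  obtain ⟨s, hs, hlim⟩ := hμ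
  haveI := isProbabilityMeasure_preWienerMeasure'
  haveI : IsProbabilityMeasure (Process.preWienerMeasure.map Γ) :=
    Measure.isProbabilityMeasure_map hΓ.aemeasurable
  have key : μ = Process.preWienerMeasure.map Γ := by
    apply ext_of_forall_integral_eq_of_IsFiniteMeasure
    intro f
    rw [integral_map hΓ.aemeasurable f.continuous.aestronglyMeasurable]
    exact tendsto_nhds_unique (hlim f) ((hT f).comp hs)
  exact ⟨Γ, hΓ, key⟩

/-- THE SOFT HALF for `hexSAWLaw`'s junk-`0` convention: tightness along the mesh + identification
of subsequential limits ⟹ convergence in law to SLE_κ (Dirac padding of the push-forward laws, the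
tree's PROVED criterion `convergesInLawToSLE_of_isTightAlongMesh` and the DISCHARGED uniqueness
`IsSLECurve.map_eq_holds`). [folklore] -/
theorem convergesInLawToSLE_of_identification (hab : IsEmbEndpointApprox hexGraph hexCenter D a b)
    (hT : IsTightAlongMesh (fun δ (γ : HexDomainSAW D.carrier δ (a δ) (b δ)) => γ.curve)
      (fun δ => hexSAWLaw D.carrier δ (a δ) (b δ)))
    (hid : ∀ μ : Measure (CurveClass ℂ), IsProbabilityMeasure μ →
      IsSubseqLimitLaw (fun δ (γ : HexDomainSAW D.carrier δ (a δ) (b δ)) => γ.curve)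
        (fun δ => hexSAWLaw D.carrier δ (a δ) (b δ)) μ → IsSLELaw κ D μ) :
    ConvergesInLawToSLE κ D (fun δ (γ : HexDomainSAW D.carrier δ (a δ) (b δ)) => γ.curve)
      (fun δ => hexSAWLaw D.carrier δ (a δ) (b δ)) := by
  classical
  have hmeas : ∀ δ, AEMeasurable (fun γ : HexDomainSAW D.carrier δ (a δ) (b δ) => γ.curve)
      (hexSAWLaw D.carrier δ (a δ) (b δ)) := fun δ =>
    (EmbDomainSAW.measurable_of_top _).aemeasurable
  let Q : ℝ → Measure (CurveClass ℂ) := fun δ =>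
    (hexSAWLaw D.carrier δ (a δ) (b δ)).map fun γ : HexDomainSAW D.carrier δ (a δ) (b δ) => γ.curve
  let c₀ : CurveClass ℂ := CurveClass.mk ⟨ContinuousMap.const _ 0⟩
  let Q' : ℝ → Measure (CurveClass ℂ) := fun δ =>
    if IsProbabilityMeasure (Q δ) then Q δ else Measure.dirac c₀
  haveI hQ' : ∀ δ, IsProbabilityMeasure (Q' δ) := fun δ => by
    by_cases h : IsProbabilityMeasure (Q δ)
    · simp only [Q', if_pos h]; exact h
    · simp only [Q', if_neg h]; infer_instance
  have hev : ∀ᶠ δ in 𝓝[>] (0 : ℝ), Q' δ = Q δ := by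
    filter_upwards [eventually_isProbabilityMeasure_hexSAWLaw hab] with δ hδ
    have : IsProbabilityMeasure (Q δ) := Measure.isProbabilityMeasure_map (hmeas δ)
    simp only [Q', if_pos this]
  have hint : ∀ δ (f : CurveClass ℂ →ᵇ ℝ), Q' δ = Q δ →
      ∫ x, f x ∂Q' δ = ∫ ω, f ω.curve ∂hexSAWLaw D.carrier δ (a δ) (b δ) := by
    intro δ f hδ
    rw [hδ]
    exact integral_map (hmeas δ) f.continuous.aestronglyMeasurable
  have hconv : ConvergesInLawToSLE κ D (fun _ => (id : CurveClass ℂ → CurveClass ℂ)) Q' := by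
    apply convergesInLawToSLE_of_isTightAlongMesh IsSLECurve.map_eq_holds
    · exact Eventually.of_forall fun δ => aemeasurable_id
    · intro ε hε
      obtain ⟨K, hK, hKev⟩ := hT ε hε
      refine ⟨K, hK, ?_⟩
      filter_upwards [hKev, hev] with δ h1 h2
      rw [h2, Set.preimage_id_eq, id,
        Measure.map_apply (EmbDomainSAW.measurable_of_top _) hK.isClosed.isOpen_compl.measurableSet]
      exact h1
    · rintro μ hμ ⟨s, hs, hlim⟩
      apply hid μ hμ
      refine ⟨s, hs, fun f => ?_⟩
      have hev' : ∀ᶠ n in atTop, Q' (s n) = Q (s n) := hs.eventually hev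
      apply (hlim f).congr'
      filter_upwards [hev'] with n hn
      exact hint _ f hn
  obtain ⟨Γ, hΓ, -, hTL⟩ := hconv
  refine ⟨Γ, hΓ, Eventually.of_forall hmeas, fun f => ?_⟩
  apply (hTL f).congr'
  filter_upwards [hev] with δ hδ
  exact hint δ f hδ

/-- NON-VACUITY OF THE IDENTIFICATION TARGET: under eventual tightness, subsequential limit laws of
the critical hexagonal SAW EXIST (Prokhorov, via the same Dirac padding). [folklore] -/
theorem exists_isSubseqLimitLaw_of_tight (hab : IsEmbEndpointApprox hexGraph hexCenter D a b)
    (hT : IsTightAlongMesh (fun δ (γ : HexDomainSAW D.carrier δ (a δ) (b δ)) => γ.curve)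
      (fun δ => hexSAWLaw D.carrier δ (a δ) (b δ))) :
    ∃ μ : Measure (CurveClass ℂ), IsProbabilityMeasure μ ∧
      IsSubseqLimitLaw (fun δ (γ : HexDomainSAW D.carrier δ (a δ) (b δ)) => γ.curve)
        (fun δ => hexSAWLaw D.carrier δ (a δ) (b δ)) μ := by
  classical
  have hmeas : ∀ δ, AEMeasurable (fun γ : HexDomainSAW D.carrier δ (a δ) (b δ) => γ.curve)
      (hexSAWLaw D.carrier δ (a δ) (b δ)) := fun δ =>
    (EmbDomainSAW.measurable_of_top _).aemeasurable
  let Q : ℝ → Measure (CurveClass ℂ) := fun δ =>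
    (hexSAWLaw D.carrier δ (a δ) (b δ)).map fun γ : HexDomainSAW D.carrier δ (a δ) (b δ) => γ.curve
  let c₀ : CurveClass ℂ := CurveClass.mk ⟨ContinuousMap.const _ 0⟩
  let Q' : ℝ → Measure (CurveClass ℂ) := fun δ =>
    if IsProbabilityMeasure (Q δ) then Q δ else Measure.dirac c₀
  haveI hQ' : ∀ δ, IsProbabilityMeasure (Q' δ) := fun δ => by
    by_cases h : IsProbabilityMeasure (Q δ)
    · simp only [Q', if_pos h]; exact h
    · simp only [Q', if_neg h]; infer_instance
  have hev : ∀ᶠ δ in 𝓝[>] (0 : ℝ), Q' δ = Q δ := by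
    filter_upwards [eventually_isProbabilityMeasure_hexSAWLaw hab] with δ hδ
    have : IsProbabilityMeasure (Q δ) := Measure.isProbabilityMeasure_map (hmeas δ)
    simp only [Q', if_pos this]
  have hint : ∀ δ (f : CurveClass ℂ →ᵇ ℝ), Q' δ = Q δ →
      ∫ x, f x ∂Q' δ = ∫ ω, f ω.curve ∂hexSAWLaw D.carrier δ (a δ) (b δ) := by
    intro δ f hδ
    rw [hδ]
    exact integral_map (hmeas δ) f.continuous.aestronglyMeasurable
  have hT' : IsTightAlongMesh (fun _ => (id : CurveClass ℂ → CurveClass ℂ)) Q' := by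
    intro ε hε
    obtain ⟨K, hK, hKev⟩ := hT ε hε
    refine ⟨K, hK, ?_⟩
    filter_upwards [hKev, hev] with δ h1 h2
    rw [h2, Set.preimage_id_eq, id,
      Measure.map_apply (EmbDomainSAW.measurable_of_top _) hK.isClosed.isOpen_compl.measurableSet]
    exact h1
  obtain ⟨μ, hμ, s, hs, hlim⟩ :=
    hT'.exists_isSubseqLimitLaw (Eventually.of_forall fun δ => aemeasurable_id)
  refine ⟨μ, hμ, s, hs, fun f => ?_⟩
  have hev' : ∀ᶠ n in atTop, Q' (s n) = Q (s n) := hs.eventually hev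
  apply (hlim f).congr'
  filter_upwards [hev'] with n hn
  exact hint _ f hn

end Identification

/-- THE CRUX IS EXACTLY IDENTIFICATION: `ObservableToSLE` is equivalent to "`HexObservableLimit` +
`HexTight` identify every subsequential limit law of the critical hexagonal SAW as the chordal
SLE(8/3) law" (soft half proved; `HexTight` enters only through Prokhorov). [folklore] -/
theorem observableToSLE_iff_identification :
    SAWDevelopingMap.ObservableToSLE ↔
      (SAWDevelopingMap.HexObservableLimit → SAWDevelopingMap.HexTight →
        ∀ (D : DobrushinDomain) (a b : ℝ → HexVertex),
          IsEmbEndpointApprox hexGraph hexCenter D a b →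
            ∀ μ : Measure (CurveClass ℂ), IsProbabilityMeasure μ →
              IsSubseqLimitLaw (fun δ (γ : HexDomainSAW D.carrier δ (a δ) (b δ)) => γ.curve)
                (fun δ => hexSAWLaw D.carrier δ (a δ) (b δ)) μ →
                IsSLELaw ((8 : ℝ≥0) / 3) D μ) := by
  constructor
  · intro h hO hT D a b hab μ hμ hsub
    haveI := hμ
    exact isSLELaw_of_isSubseqLimitLaw (h hO hT D a b hab) hsub
  · intro h hO hT D a b hab
    exact convergesInLawToSLE_of_identification hab (hT D a b hab) (h hO hT D a b hab)

end Summit.CriticalPhenomena.SAWScalingLimit.Theorems.ObservableToSLE.Negative
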